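import Literature.NumberTheory.LFunctions.WeilExplicitApproxIdentity
import Literature.NumberTheory.LFunctions.WeilBochnerExtensionChar
import HarnessLib

/-!
# Weil's functional of a Dirichlet character along an approximate identity

Topic `Literature/NumberTheory/LFunctions`; the `χ`-twisted twin of `WeilExplicitApproxIdentity.lean`
(`W_χ = weilFunctionalChar χ` of `WeilExplicitDirichlet.lean`).  Everything here is PROVED; no
definitions, no named facts.

For an approximate identity `u_n` (continuous, `u_n = 0` off `[-δ_n, δ_n]`, `δ_n ≤ 1`, `δ_n → 0`,
`∫ u_n = ∫ ‖u_n‖ = 1`) and `g` continuous of compact support whose archimedean integrand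
`ĝ(½+it) Re ψ(¼ + a_χ/2 + it/2)` is integrable: `W_χ(g ⋆ u_n) → W_χ(g)` (`tendsto_weilFunctionalChar`).
The polar side is the `ζ`-file's (`WeilApproxIdentity.tendsto_weilPolarTerm`); the prime side is a fixed
finite sum with the weights `χ(n)`, `χ̄(n)` (`weilPrimeTermChar_eq_sum_of_support`,
`tendsto_weilPrimeTermChar`); the archimedean integral converges by dominated convergence
(`tendsto_weilArchIntegralChar`).  This is the mollification step of the Bochner–Kreĭn theory of the
GRH arm (continuous band-limited kernels). [cite: Weil1952FormulesExplicites, (11) pp. 261–262]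
-/

noncomputable section

open Complex Filter Set MeasureTheory Topology
open scoped Real ComplexConjugate ArithmeticFunction.vonMangoldt

namespace Literature.NumberTheory.LFunctions

namespace WeilApproxIdentityChar

variable {q : ℕ} (χ : DirichletCharacter ℂ q) {g : ℝ → ℂ} {u : ℕ → ℝ → ℂ} {δ : ℕ → ℝ}

/-- The twisted prime term as a finite sum when the kernel vanishes for `|u| > R`.
[cite: Weil1952FormulesExplicites, (11) pp. 261–262, prime term] -/
theorem weilPrimeTermChar_eq_sum_of_support {f : ℝ → ℂ} {R : ℝ} (hf : ∀ v : ℝ, R < |v| → f v = 0) :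
    weilPrimeTermChar χ f = ∑ n ∈ Finset.range ⌈Real.exp (R + 1)⌉₊,
      ((Λ n : ℝ) : ℂ) / (Real.sqrt n : ℂ) *
        (χ (n : ZMod q) * f (Real.log n) + conj (χ (n : ZMod q)) * f (-Real.log n)) := by
  unfold weilPrimeTermChar
  refine tsum_eq_sum fun n hn ↦ ?_
  rw [Finset.mem_range, not_lt] at hn
  have hn' : Real.exp (R + 1) ≤ n := (Nat.le_ceil _).trans (by exact_mod_cast hn)
  have hpos : (0 : ℝ) < n := (Real.exp_pos _).trans_le hn'
  have hlog : R + 1 ≤ Real.log n := by rwa [Real.le_log_iff_exp_le hpos]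
  have h1 : R < |Real.log n| := lt_of_lt_of_le (by linarith) (le_abs_self _)
  rw [hf _ h1, hf _ (by rwa [abs_neg]), mul_zero, mul_zero, add_zero, mul_zero]

/-- Convergence of the twisted prime term along the approximate identity.
[cite: Weil1952FormulesExplicites, (11) pp. 261–262, prime term] -/
theorem tendsto_weilPrimeTermChar (huc : ∀ n, Continuous (u n)) (hδ : Tendsto δ atTop (𝓝 0))
    (hδ1 : ∀ n, δ n ≤ 1) (hus : ∀ n x, δ n ≤ |x| → u n x = 0) (hu1 : ∀ n, ∫ x, u n x = 1)
    (hun : ∀ n, ∫ x, ‖u n x‖ = 1) (hgc : Continuous g) (hgs : HasCompactSupport g) :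
    Tendsto (fun n => weilPrimeTermChar χ (weilConv g (u n))) atTop (𝓝 (weilPrimeTermChar χ g)) := by
  obtain ⟨R, hR0, hR⟩ := WeilContinuous.exists_support_radius hgs
  have hRn : ∀ n, ∀ v : ℝ, R + 1 < |v| → weilConv g (u n) v = 0 := fun n v hv =>
    WeilApproxIdentity.weilConv_eq_zero hδ1 hus hR hv n
  have hR' : ∀ v : ℝ, R + 1 < |v| → g v = 0 := fun v hv => hR v (by linarith)
  rw [weilPrimeTermChar_eq_sum_of_support χ hR']
  simp_rw [weilPrimeTermChar_eq_sum_of_support χ (hRn _)]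
  refine tendsto_finsetSum _ fun m _ => ?_
  exact tendsto_const_nhds.mul
    ((tendsto_const_nhds.mul (WeilApproxIdentity.tendsto_weilConv huc hδ hus hu1 hun hgc _)).add
      (tendsto_const_nhds.mul (WeilApproxIdentity.tendsto_weilConv huc hδ hus hu1 hun hgc _)))

/-- Convergence of the shifted archimedean integral (dominated convergence).
[cite: Weil1952FormulesExplicites, (11) pp. 261–262, archimedean term] -/
theorem tendsto_weilArchIntegralChar (a : ℕ) (huc : ∀ n, Continuous (u n)) (hδ : Tendsto δ atTop (𝓝 0))
    (hus : ∀ n x, δ n ≤ |x| → u n x = 0) (hu1 : ∀ n, ∫ x, u n x = 1)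
    (hun : ∀ n, ∫ x, ‖u n x‖ = 1) (hgc : Continuous g) (hgs : HasCompactSupport g)
    (hA : Integrable fun t : ℝ => weilMellin g (1 / 2 + t * I) *
      ((Complex.digamma (1 / 4 + (a : ℂ) / 2 + t / 2 * I)).re : ℂ)) :
    Tendsto (fun n => weilArchIntegralChar a (weilConv g (u n))) atTop
      (𝓝 (weilArchIntegralChar a g)) := by
  -- adapted from `WeilApproxIdentity.tendsto_weilArchIntegral` (tree)
  unfold weilArchIntegralChar
  have hM : ∀ n s, weilMellin (weilConv g (u n)) s = weilMellin g s * weilMellin (u n) s := fun n s =>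
    weilMellin_weilConv_holds hgc hgs (huc n) (WeilApproxIdentity.hasCompactSupport_of_vanish hus n) s
  simp_rw [hM]
  refine tendsto_integral_of_dominated_convergence
    (fun t => ‖weilMellin g (1 / 2 + t * I) *
      ((Complex.digamma (1 / 4 + (a : ℂ) / 2 + t / 2 * I)).re : ℂ)‖) ?_ hA.norm ?_ ?_
  · intro n
    have hc : Continuous fun t : ℝ => weilMellin (u n) (1 / 2 + t * I) :=
      (continuous_weilMellin (huc n) (WeilApproxIdentity.hasCompactSupport_of_vanish hus n)).comp
        (by fun_prop)
    have heq : (fun t : ℝ => weilMellin g (1 / 2 + t * I) * weilMellin (u n) (1 / 2 + t * I) *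
        ((Complex.digamma (1 / 4 + (a : ℂ) / 2 + t / 2 * I)).re : ℂ)) = fun t : ℝ =>
        (weilMellin g (1 / 2 + t * I) * ((Complex.digamma (1 / 4 + (a : ℂ) / 2 + t / 2 * I)).re : ℂ)) *
          weilMellin (u n) (1 / 2 + t * I) := by
      funext t; ring
    rw [heq]
    exact hA.aestronglyMeasurable.mul hc.aestronglyMeasurable
  · intro n
    refine Eventually.of_forall fun t => ?_
    have h1 := WeilApproxIdentity.norm_weilMellin_half_le hun n t
    calc ‖weilMellin g (1 / 2 + t * I) * weilMellin (u n) (1 / 2 + t * I) *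
          ((Complex.digamma (1 / 4 + (a : ℂ) / 2 + t / 2 * I)).re : ℂ)‖
        = ‖weilMellin g (1 / 2 + t * I) *
            ((Complex.digamma (1 / 4 + (a : ℂ) / 2 + t / 2 * I)).re : ℂ)‖ *
            ‖weilMellin (u n) (1 / 2 + t * I)‖ := by
          rw [norm_mul, norm_mul, norm_mul]; ring
      _ ≤ ‖weilMellin g (1 / 2 + t * I) *
            ((Complex.digamma (1 / 4 + (a : ℂ) / 2 + t / 2 * I)).re : ℂ)‖ * 1 := by
          gcongr
      _ = _ := mul_one _
  · refine Eventually.of_forall fun t => ?_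
    have h := ((WeilApproxIdentity.tendsto_weilMellin huc hδ hus hu1 hun (1 / 2 + t * I)).const_mul
      (weilMellin g (1 / 2 + t * I))).mul_const
        ((Complex.digamma (1 / 4 + (a : ℂ) / 2 + t / 2 * I)).re : ℂ)
    simpa using h

/-- **`W_χ` along an approximate identity**: `W_χ(g ⋆ u_n) → W_χ(g)` for `g` continuous of compact
support whose shifted archimedean integrand is integrable (in particular for Weil tests,
`WeilBochnerChar.integrable_archChar_of_isWeilTest`). [cite: Weil1952FormulesExplicites, (11) pp. 261–262] -/
theorem tendsto_weilFunctionalChar (huc : ∀ n, Continuous (u n)) (hδ : Tendsto δ atTop (𝓝 0))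
    (hδ1 : ∀ n, δ n ≤ 1) (hus : ∀ n x, δ n ≤ |x| → u n x = 0) (hu1 : ∀ n, ∫ x, u n x = 1)
    (hun : ∀ n, ∫ x, ‖u n x‖ = 1) (hgc : Continuous g) (hgs : HasCompactSupport g)
    (hA : Integrable fun t : ℝ => weilMellin g (1 / 2 + t * I) *
      ((Complex.digamma (1 / 4 + (charParity χ : ℂ) / 2 + t / 2 * I)).re : ℂ)) :
    Tendsto (fun n => weilFunctionalChar χ (weilConv g (u n))) atTop (𝓝 (weilFunctionalChar χ g)) := by
  unfold weilFunctionalChar weilArchTermChar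
  have hP := WeilApproxIdentity.tendsto_weilPolarTerm huc hδ hus hu1 hun hgc hgs
  have hPr := tendsto_weilPrimeTermChar χ huc hδ hδ1 hus hu1 hun hgc hgs
  have hAI := tendsto_weilArchIntegralChar (charParity χ) huc hδ hus hu1 hun hgc hgs hA
  have h0 := WeilApproxIdentity.tendsto_weilConv huc hδ hus hu1 hun hgc 0
  have hpol : Tendsto (fun n => if q = 1 then weilPolarTerm (weilConv g (u n)) else 0) atTop
      (𝓝 (if q = 1 then weilPolarTerm g else 0)) := by
    split_ifs
    · exact hP
    · exact tendsto_const_nhds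
  exact (hpol.sub hPr).add ((hAI.const_mul _).add (h0.mul_const _))

end WeilApproxIdentityChar

end Literature.NumberTheory.LFunctions

end
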